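import Mathlib.RingTheory.Unramified.LocalRing
import Mathlib.RingTheory.Smooth.Flat
import Mathlib.FieldTheory.IsSepClosed
import Literature.RingTheory.Idempotents.FiniteAlgebraLocalFactorsRank
import HarnessLib

/-!
# A finite flat unramified local algebra over a local ring with separably closed residue field has rank one
# ([StacksProject 00UW, 04GL]; [EGAIV4] 18.5.11)

Topic `Literature/RingTheory/Etale`; namespace `Literature.RingTheory.Etale`.  PROOF FILE (theorems only; no definition, no named
fact, no instance, no `sorry`; imports Mathlib + ★ `Literature.RingTheory.Idempotents.FiniteAlgebraLocalFactorsRank`).  Cell `hodgecm-mathlib`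
(D-0151), FLOOR 0, programme F0P5a (D9op road 2′, crux item stmt-HodgeConjecture-24832), (γ3-GENERIC) row **Γ3-E0** of the desk
`F0/P5a/Gamma3-DESK.v0.1.F0P5a-plan-g2.lean` (decl `FinrankEqOneOfUnramifiedLocal`): the algebra leaf behind «MULTIPLICITY ONE at an étale
point» of the two-section pushforward bridge (MOD-PLAN row L5.5b).

SETTING.  `(R, 𝔪_R, κ(R))` a local ring; `C` a LOCAL `R`-algebra, module-finite and flat over `R`, formally unramified over `R`.  In the
application `R` is the henselian valuation ring `𝒪_{\bar K_v}` (residue field algebraically closed) and `C` is the local factor at an étale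
point of the coordinate ring of a finite flat cover base-changed along an integral point — the currency of ★ p800184
`ValuationSubring.card_algHom_residue_comp_eq` (`Module.finrank V (B ⧸ Ideal.span {1 - e I})`).

RESULTS.
* §1 `finrank_residueField_eq_one_of_isSepClosed` — if `κ(R)` is separably closed, the residue extension of a formally unramified local
  `R`-algebra essentially of finite type is trivial: `[κ(C) : κ(R)] = 1` (Mathlib: `κ(C)/κ(R)` is finite separable for unramified local maps,
  [StacksProject 00UW (2)]; `IsSepClosed.algebraMap_bijective`); `length_residueField_eq_one_of_isSepClosed` the same as a length.
* §2 **`finrank_eq_one_of_formallyUnramified_of_isSepClosed`** — `rank_R C = 1`: `C` is free (finite flat over local, [StacksProject 00NZ]),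
  `rank_R C = ℓ_C(C ⧸ 𝔪_R C) · ℓ_{κ(R)} κ(C)` (★ `finrank_eq_length_quotient_mul_length_residueField`, [StacksProject 02M0]), `𝔪_R C = 𝔪_C`
  for unramified local maps ([StacksProject 00UW (1)], Mathlib `Algebra.FormallyUnramified.map_maximalIdeal`), and `C ⧸ 𝔪_C` is simple.
  Variants: `…_of_isAlgClosed` (algebraically closed residue field), and `finrank_eq_one_of_etale_of_isSepClosed` (`C` étale over `R`).
  This is the special case `n = 1`, `e = f = 1` of [EGAIV4] 18.5.11 / [StacksProject 04GL] («`R → C` finite étale local with trivial residue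
  extension is an isomorphism»), of which only the rank statement is needed downstream.

HC_CM is proved only modulo the 7 printed citations until rung 0 closes; this file is generic commutative algebra and changes no count.

## References
* [StacksProject] The Stacks Project: Tag 00UW (Algebra, Lemma 10.151.5: unramified local maps have `𝔪_R C = 𝔪_C` and finite separable
  residue extension), Tag 04GL (Algebra, Lemma 10.153.5), Tag 02M0 (Algebra, Lemma 10.52.12), Tag 00NZ (finite flat over local is free).
* [EGAIV4] A. Grothendieck, J. Dieudonné, *Éléments de géométrie algébrique IV₄*, Publ. Math. IHÉS 32 (1967), Prop. 18.5.11.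
-/

set_option autoImplicit false

namespace Literature.RingTheory.Etale

open IsLocalRing Module

/-! ### §1 The residue extension of an unramified local algebra over a separably closed residue field is trivial -/

section Residue

variable {R C : Type*} [CommRing R] [IsLocalRing R] [CommRing C] [IsLocalRing C] [Algebra R C]

/-- **Trivial residue extension**: for a local `R`-algebra `C` essentially of finite type along a local structure map, formally unramified
over `R`, the residue field `κ(C)` is a finite separable extension of `κ(R)` ([StacksProject 00UW (2)], Mathlib); if `κ(R)` is separably
closed it follows that `κ(R) → κ(C)` is bijective, i.e. `[κ(C) : κ(R)] = 1`. [cite: StacksProject, Tag 00UW] -/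
theorem finrank_residueField_eq_one_of_isSepClosed [IsLocalHom (algebraMap R C)] [Algebra.EssFiniteType R C]
    [Algebra.FormallyUnramified R C] [IsSepClosed (ResidueField R)] :
    Module.finrank (ResidueField R) (ResidueField C) = 1 := by
  have hbij := IsSepClosed.algebraMap_bijective (k := ResidueField R) (ResidueField C)
  let e : ResidueField R ≃ₗ[ResidueField R] ResidueField C :=
    LinearEquiv.ofBijective (Algebra.linearMap (ResidueField R) (ResidueField C)) hbij
  rw [← e.finrank_eq, Module.finrank_self]

/-- The same statement as a LENGTH: `ℓ_{κ(R)} κ(C) = 1` (the residue-degree factor of ★ `finrank_eq_length_quotient_mul_length_residueField`).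
[cite: StacksProject, Tag 00UW] -/
theorem length_residueField_eq_one_of_isSepClosed [IsLocalHom (algebraMap R C)] [Algebra.EssFiniteType R C]
    [Algebra.FormallyUnramified R C] [IsSepClosed (ResidueField R)] :
    Module.length (ResidueField R) (ResidueField C) = 1 := by
  rw [Module.length_eq_finrank, finrank_residueField_eq_one_of_isSepClosed (R := R) (C := C), Nat.cast_one]

end Residue

/-! ### §2 Rank one -/

section RankOne

variable {R C : Type*} [CommRing R] [IsLocalRing R] [CommRing C] [IsLocalRing C] [Algebra R C]

/-- The special fibre of an unramified local algebra is its residue field: `ℓ_C (C ⧸ 𝔪_R C) = 1` (`𝔪_R C = 𝔪_C` by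
[StacksProject 00UW (1)], Mathlib `Algebra.FormallyUnramified.map_maximalIdeal`, and `C ⧸ 𝔪_C` is a simple `C`-module). [cite: StacksProject, Tag 00UW] -/
theorem length_quotient_map_maximalIdeal_eq_one [IsLocalHom (algebraMap R C)] [Algebra.EssFiniteType R C]
    [Algebra.FormallyUnramified R C] :
    Module.length C (C ⧸ (maximalIdeal R).map (algebraMap R C)) = 1 := by
  rw [Algebra.FormallyUnramified.map_maximalIdeal (R := R) (S := C), Module.length_eq_one_iff]
  exact (isSimpleModule_iff_isCoatom.2 (Ideal.isMaximal_def.1 (maximalIdeal.isMaximal C)))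

/-- **A finite flat unramified local algebra over a local ring with separably closed residue field has rank one** (row Γ3-E0 of the F0P5a
(γ3-GENERIC) desk; [EGAIV4] 18.5.11 / [StacksProject 04GL] in rank form).  `C` local, module-finite and flat over the local ring `R`, formally
unramified over `R`, `κ(R)` separably closed ⇒ `rank_R C = 1`.  Proof: the structure map is local (`C ≠ 0` module-finite, Nakayama); `C` is free
([StacksProject 00NZ]); `rank_R C = ℓ_C(C ⧸ 𝔪_R C) · ℓ_{κ(R)} κ(C)` ([StacksProject 02M0], ★ `finrank_eq_length_quotient_mul_length_residueField`)
`= 1 · 1`. [cite: EGAIV4, Prop. 18.5.11] [cite: StacksProject, Tag 04GL] [cite: StacksProject, Tag 00UW] -/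
theorem finrank_eq_one_of_formallyUnramified_of_isSepClosed [Module.Finite R C] [Module.Flat R C]
    [Algebra.FormallyUnramified R C] [IsSepClosed (ResidueField R)] : Module.finrank R C = 1 := by
  haveI : IsLocalHom (algebraMap R C) := Literature.RingTheory.Idempotents.isLocalHom_algebraMap_of_module_finite
  haveI : Module.Free R C := Module.free_of_flat_of_isLocalRing
  haveI : Algebra.FiniteType R C := Module.Finite.finiteType C
  haveI : Algebra.EssFiniteType R C := Algebra.EssFiniteType.of_finiteType R C
  have h := Literature.RingTheory.Idempotents.finrank_eq_length_quotient_mul_length_residueField (R := R) (B := C)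
  rw [length_quotient_map_maximalIdeal_eq_one (R := R) (C := C), length_residueField_eq_one_of_isSepClosed (R := R) (C := C),
    mul_one, Nat.cast_eq_one] at h
  exact h

/-- The same over an ALGEBRAICALLY closed residue field (the case of the valuation ring `𝒪_{\bar K_v}`, whose residue field is an algebraic
closure of `κ(v)`). [cite: EGAIV4, Prop. 18.5.11] [cite: StacksProject, Tag 04GL] -/
theorem finrank_eq_one_of_formallyUnramified_of_isAlgClosed [Module.Finite R C] [Module.Flat R C]
    [Algebra.FormallyUnramified R C] [IsAlgClosed (ResidueField R)] : Module.finrank R C = 1 :=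
  finrank_eq_one_of_formallyUnramified_of_isSepClosed

/-- The same for a module-finite ÉTALE local algebra (étale ⇒ flat and formally unramified; Mathlib `Algebra.Smooth.flat`). [cite: EGAIV4, Prop. 18.5.11] [cite: StacksProject, Tag 04GL] -/
theorem finrank_eq_one_of_etale_of_isSepClosed [Module.Finite R C] [Algebra.Etale R C] [IsSepClosed (ResidueField R)] :
    Module.finrank R C = 1 := by
  haveI : Algebra.FormallyEtale R C := Algebra.Etale.formallyEtale
  haveI : Algebra.Smooth R C := ⟨inferInstance, Algebra.Etale.finitePresentation⟩
  haveI : Module.Flat R C := Algebra.Smooth.flat R C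
  exact finrank_eq_one_of_formallyUnramified_of_isSepClosed

/-- **Desk form** (the `Prop` `FinrankEqOneOfUnramifiedLocal` of `F0/P5a/Gamma3-DESK.v0.1`, universe-polymorphic): for ALL such `R`, `C`,
`Module.finrank R C = 1`. [cite: EGAIV4, Prop. 18.5.11] [cite: StacksProject, Tag 04GL] -/
theorem forall_finrank_eq_one_of_formallyUnramified :
    ∀ (R C : Type*) [CommRing R] [IsLocalRing R] [CommRing C] [IsLocalRing C] [Algebra R C] [Module.Finite R C] [Module.Flat R C]
      [Algebra.FormallyUnramified R C] [IsSepClosed (ResidueField R)], Module.finrank R C = 1 :=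
  fun _ _ _ _ _ _ _ _ _ _ _ => finrank_eq_one_of_formallyUnramified_of_isSepClosed

end RankOne

end Literature.RingTheory.Etale
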